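import Summits.CriticalPhenomena.Ising3DConformalLimit.Theses.HyperoctahedralRP
import Summits.CriticalPhenomena.Ising3DConformalLimit.Theses.IsingEuclidUpgrade
import Summits.CriticalPhenomena.Ising3DConformalLimit.Theses.ArmHyperscaling
import Summits.CriticalPhenomena.Ising3DConformalLimit.Theorems.LeeYangGapGaussianLimitKillsBlockCoupling
import Summits.CriticalPhenomena.Ising3DConformalLimit.Theorems.PerfectScreeningCoulombImpliesNontrivialBlockFieldDomination
import Literature.Probability.LatticeModels.PointwiseScalingLimitScaleCovariant
import Literature.Probability.LatticeModels.HighDimPointwiseTriviality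
import Literature.Probability.LatticeModels.CriticalTwoPointLower
import Literature.Barriers.CriticalPhenomena.IsingTrivialityFromDimensionFourProofs

/-!
# Line `isotherm-saturation-lee-yang` for crux stmt-CriticalPhenomena-0636
(`IsingEuclidUpgradeR4NonGaussian`, primary route HyperoctahedralRP; shared decl of IsingEuclidUpgrade)

**Idea.** Non-triviality of EVERY non-degenerate pointwise scaling limit of the critical Ising₃
correlators follows from ONE one-point, monotone (GKS/GHS/FKG-friendly) lattice inequality:
SATURATION OF THE CRITICAL ISOTHERM AT THE CLT FIELD SCALE — with `Σ_L = ⟨M_L²⟩_{β_c}`,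
`M_L = Σ_{x ∈ Λ_L} σ_x`, `Λ_L = box 3 L`, and the matched field `h_L := C/√Σ_L` (`C` Zeeman standard
deviations), the infinite-volume critical magnetisation obeys
`|Λ_L| · m(β_c, h_L) ≤ ½ · (β_c h_L) · Σ_L` for all large `L` (half the linear response of the block).
In exponent language this is the hyperscaling EQUALITY `δ = (d + 2 - η)/(d - 2 + η)` read as an upper
bound on `m(β_c, ·)` with amplitude (the reverse, `δ ≥ …`, is the rigorous Buckingham–Gunton/Fisher
inequality); it is predicted true on `ℤ³` (δ ≈ 4.79) and is FALSE for `d ≥ 5` (mean-field `δ = 3`),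
so it carries exactly the `d < 4` input that `Disproof.lean §D` demands.

Chain (all arrows but S1/S3 are landed theorems or provable-now stubs):
* GKS block-field domination (LANDED, `stub_blockFieldDomination` of line SketchPub, route
  PerfectScreening): `⟨M_L e^{β_c h M_L}⟩ ≤ |Λ_L| m(β_c,h) ⟨e^{β_c h M_L}⟩`;
* S2 `stub_leeYangDeficit` (provable now from the LANDED Lee–Yang package of the critical block law,
  `stub_blockLaw` + `stub_leeYangPackage`: `⟨e^{tM_L}⟩ = cosh^m t ∏ (1 + bᵢ sinh² t)`, `bᵢ ≥ 1`,
  `Σ_L = m + 2∑bᵢ`, Newman's coefficient inequality `2m + 12∑bᵢ² - 8∑bᵢ ≤ 3Σ_L² - ⟨M_L⁴⟩`):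
  the SATURATION DEFICIT of the tilted block is controlled by the fourth cumulant,
  `Σ_L t - ⟨M_L e^{tM_L}⟩/⟨e^{tM_L}⟩ ≤ t³ (3Σ_L² - ⟨M_L⁴⟩)` for every `t ≥ 0`
  (elementary: `t - tanh t ≤ t³/3`, `bᵢ(t - s c/(1 + bᵢ s²)) ≤ 1.39 bᵢ² t³` on `[0,1]`, `≤ bᵢ t ≤ bᵢ²t³`
  beyond; and `3Σ² - Q ≥ 2m + 4∑bᵢ²` since `bᵢ ≥ 1`);
* hence at `t_L = β_c h_L`: `½ t_L Σ_L ≤ t_L³ (3Σ_L² - Q_L)`, i.e. the block Binder coupling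
  `g_L := (3Σ_L² - Q_L)/Σ_L² ≥ 1/(2 β_c² C²)` for all large `L` (`binder_lower_of_saturation`);
* while a non-degenerate pointwise limit with `U₄ ≡ 0` forces `g_L → 0` (LANDED,
  `gaussianLimitKillsBlockCoupling_proof`, route LeeYangGap item 4950; scale covariance is automatic,
  `HasPointwiseScalingLimit.exists_rpow_scale_mem_Icc`, after normalising `S` off `NonCoincident`).
Second entrance: S3 = the EXISTING shared crux `ArmHyperscaling.OneArmHyperscaling`
(stmt-CriticalPhenomena-15591, Tasaki saturation `(m⁺_{Λ_{Kn}})² ≤ C⟨σ₀σ_{2ne₀}⟩`) implies S1 by the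
LANDED GHS tangent line (`boxMag_le_zeroField_add_field_mul`, `isingTrunc_plus_box_le_plusExpect`,
`plusCorr_le_isingCorr_plus_box`) and two-point bookkeeping from the limit (`card_sq_mul_axis_le_blockSum`,
`card_mul_boxSum_le_blockSum`, the doubling lemma `exists_eta_boxSum_floor_le`, MMS): S4
`stub_oneArmGivesMatchedIsotherm`. So ONE lattice number (15591) now carries both O(3)-invariance
(route ArmHyperscaling, IsotropyFromOneArm) and clause (iii); `MergingFloor` (15592) is not needed.

The compositions `IsingEuclidUpgradeR4NonGaussian_of` (S2 → S1 → crux, IsingEuclidUpgrade decl),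
`…_of_hyperoctahedralRP` (HyperoctahedralRP copy) and `…_of_oneArm` (S2 → S4 → S3 → crux) are sorry-free and take
EXACTLY the stub statements as hypotheses; sorries live only in the four `stub_*`.
-/

noncomputable section

namespace Summit.CriticalPhenomena.Ising3DConformalLimit.Cruxes.IsingEuclidUpgradeR4NonGaussian.IsothermSaturationLeeYang

open Literature.Probability.LatticeModels Filter Set Finset
open scoped Topology BigOperators

/-! ## Registered stubs (the four statements of the line, each spelled out; the compositions below take
EXACTLY these statements as hypotheses) -/

/-- **S1 — MATCHED UPPER CRITICAL ISOTHERM** (OPEN — the hardest stub; the new heart of this line).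
Saturation of the critical magnetisation at the CLT field scale: for every non-degenerate, scale-covariant
pointwise scaling limit (the hypotheses are only offered as tools — regular variation of `⟨σ₀σ_x⟩_{β_c}` — the
conclusion is a pure lattice fact) there is `C > 0` such that for all large `L`, with `Σ_L = ⟨M_L²⟩_{β_c}`,
`(2L+1)³ · m(β_c, C/√Σ_L) ≤ ½ β_c C √Σ_L` ( = half the tilt-linear response `½ (β_c h_L) Σ_L`).
Hyperscaling equality for `δ` as an UPPER bound with amplitude; false for `d ≥ 5`; open on `ℤ³`. -/
theorem stub_matchedUpperIsotherm :
    ∀ (ρ : ℝ → ℝ) (Δ : ℝ) (S : CorrFamily 3), (∀ δ ∈ Set.Ioc (0:ℝ) 1, 0 < ρ δ) →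
      HasPointwiseScalingLimit (criticalCorr 3) ρ S → IsNondegenerateTwoPoint S →
      IsScaleCovariant Δ S →
      ∃ C : ℝ, 0 < C ∧ ∀ᶠ L : ℕ in atTop,
        (2 * (L : ℝ) + 1) ^ 3 * magnetizationInField 3 (criticalBeta 3)
            (C / Real.sqrt (plusExpect 3 (criticalBeta 3) 0 (fun σ => (∑ x ∈ box 3 L, spinAt x σ) ^ 2))) ≤
          criticalBeta 3 * C / 2 *
            Real.sqrt (plusExpect 3 (criticalBeta 3) 0 (fun σ => (∑ x ∈ box 3 L, spinAt x σ) ^ 2)) := by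
  sorry

/-- **S2 — LEE–YANG SATURATION DEFICIT** (provable now, M): for the critical block spin `M_L` and every tilt
`t ≥ 0`, `⟨e^{tM_L}⟩ > 0` and `(Σ_L t - t³(3Σ_L² - ⟨M_L⁴⟩)) · ⟨e^{tM_L}⟩ ≤ ⟨M_L e^{tM_L}⟩`, i.e. the
deficit of the tilted mean below its linear response is at most `t³ · (-u₄(M_L))`. Pure consequence of the
Lee–Yang product structure of the block law (Newman 1975): from the landed `stub_blockLaw` +
`stub_leeYangPackage` (`⟨e^{tM}⟩ = cosh^m t ∏ (1 + bᵢ sinh² t)`, `bᵢ ≥ 1`, tilted mean, `Σ_L = m + 2∑bᵢ`,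
Newman `2m + 12∑bᵢ² - 8∑bᵢ ≤ 3Σ_L² - ⟨M_L⁴⟩`) and `t - tanh t ≤ t³/3`, `bᵢ(t - sc/(1+bᵢs²)) ≤ 1.39 bᵢ²t³` on
`[0,1]` (`≤ bᵢ t ≤ bᵢ² t³` beyond), `3Σ² - Q ≥ 2m + 4∑bᵢ²`. -/
theorem stub_leeYangDeficit :
    ∀ (L : ℕ) (t : ℝ), 0 ≤ t →
      0 < plusExpect 3 (criticalBeta 3) 0 (fun σ => Real.exp (t * ∑ x ∈ box 3 L, spinAt x σ)) ∧
      (plusExpect 3 (criticalBeta 3) 0 (fun σ => (∑ x ∈ box 3 L, spinAt x σ) ^ 2) * t -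
          t ^ 3 * (3 * (plusExpect 3 (criticalBeta 3) 0 (fun σ => (∑ x ∈ box 3 L, spinAt x σ) ^ 2)) ^ 2 -
            plusExpect 3 (criticalBeta 3) 0 (fun σ => (∑ x ∈ box 3 L, spinAt x σ) ^ 4))) *
        plusExpect 3 (criticalBeta 3) 0 (fun σ => Real.exp (t * ∑ x ∈ box 3 L, spinAt x σ)) ≤
      plusExpect 3 (criticalBeta 3) 0
        (fun σ => (∑ x ∈ box 3 L, spinAt x σ) * Real.exp (t * ∑ x ∈ box 3 L, spinAt x σ)) := by
  sorry

/-- **S3 — ONE-ARM HYPERSCALING** (OPEN, the existing shared crux stmt-CriticalPhenomena-15591 of route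
ArmHyperscaling, by name): `∃ K ≥ 1, C, ∀ n ≥ 1, (⟨σ₀⟩⁺_{box(Kn)})² ≤ C ⟨σ₀σ_{2ne₀}⟩_{β_c}`. -/
theorem stub_oneArmHyperscaling :
    Summit.CriticalPhenomena.Ising3DConformalLimit.Theses.ArmHyperscaling.OneArmHyperscaling := by
  sorry

/-- **S4 — ONE-ARM HYPERSCALING SATURATES THE MATCHED ISOTHERM** (provable now, M–L): GHS tangent line in
the plus box `Λ_{Kn}` (`m(β_c,h) ≤ m⁺_{box N} + β_c h χ(N)`, landed `boxMag_le_zeroField_add_field_mul`,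
`isingTrunc_plus_box_le_plusExpect`, `plusCorr_le_isingCorr_plus_box`), `Kn ≤ ⌊ηL⌋` by the doubling lemma
`exists_eta_boxSum_floor_le` with `card_mul_boxSum_le_blockSum` (field term), and
`G(2ne₀)/G(2Le₀)` bounded through `card_sq_mul_axis_le_blockSum`, MMS and the limit at `(0,(η/K)e₀)`,
`(0,2e₀)` (boundary term); then choose `C` large. -/
theorem stub_oneArmGivesMatchedIsotherm :
    Summit.CriticalPhenomena.Ising3DConformalLimit.Theses.ArmHyperscaling.OneArmHyperscaling →
    ∀ (ρ : ℝ → ℝ) (Δ : ℝ) (S : CorrFamily 3), (∀ δ ∈ Set.Ioc (0:ℝ) 1, 0 < ρ δ) →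
      HasPointwiseScalingLimit (criticalCorr 3) ρ S → IsNondegenerateTwoPoint S →
      IsScaleCovariant Δ S →
      ∃ C : ℝ, 0 < C ∧ ∀ᶠ L : ℕ in atTop,
        (2 * (L : ℝ) + 1) ^ 3 * magnetizationInField 3 (criticalBeta 3)
            (C / Real.sqrt (plusExpect 3 (criticalBeta 3) 0 (fun σ => (∑ x ∈ box 3 L, spinAt x σ) ^ 2))) ≤
          criticalBeta 3 * C / 2 *
            Real.sqrt (plusExpect 3 (criticalBeta 3) 0 (fun σ => (∑ x ∈ box 3 L, spinAt x σ) ^ 2)) := by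
  sorry

/-! ## Composition (sorry-free) -/

/-- The real arithmetic at one block: deficit + domination + matched isotherm give the Binder floor.
With `Sg = Σ_L > 0`, `t = β C/√Sg`, `K = 3Σ_L² - ⟨M_L⁴⟩`, `Z = ⟨e^{tM}⟩ > 0`:
`(Sg t - t³K) Z ≤ T ≤ Nm Z` and `Nm ≤ β C/2 · √Sg` force `1/(2β²C²) ≤ K/Sg²`. -/
theorem binder_lower_of_saturation {β C Sg K Z T Nm : ℝ} (hβ : 0 < β) (hC : 0 < C) (hSg : 0 < Sg)
    (hZ : 0 < Z)
    (hdef : (Sg * (β * (C / Real.sqrt Sg)) - (β * (C / Real.sqrt Sg)) ^ 3 * K) * Z ≤ T)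
    (hdom : T ≤ Nm * Z) (hiso : Nm ≤ β * C / 2 * Real.sqrt Sg) :
    1 / (2 * β ^ 2 * C ^ 2) ≤ K / Sg ^ 2 := by
  set s : ℝ := Real.sqrt Sg with hs
  have hs0 : 0 < s := Real.sqrt_pos.2 hSg
  have hs2 : s ^ 2 = Sg := Real.sq_sqrt hSg.le
  set t : ℝ := β * (C / s) with ht
  have ht0 : 0 < t := by positivity
  -- cancel `Z`
  have h1 : Sg * t - t ^ 3 * K ≤ Nm := le_of_mul_le_mul_right (hdef.trans hdom) hZ
  -- `Nm ≤ t Sg / 2`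
  have h2 : β * C / 2 * s = t * Sg / 2 := by
    rw [ht, ← hs2]; field_simp
  have h3 : Sg * t - t ^ 3 * K ≤ t * Sg / 2 := h1.trans (hiso.trans_eq h2)
  -- hence `Sg / 2 ≤ t² K`
  have h4 : t * (Sg / 2) ≤ t * (t ^ 2 * K) := by nlinarith
  have h5 : Sg / 2 ≤ t ^ 2 * K := le_of_mul_le_mul_left h4 ht0
  -- `t² Sg = β² C²`
  have h6 : t ^ 2 * Sg = β ^ 2 * C ^ 2 := by
    rw [ht, ← hs2]; field_simp
  have hSg2 : 0 < Sg ^ 2 := by positivity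
  rw [div_le_div_iff₀ (by positivity) hSg2]
  calc 1 * Sg ^ 2 = 2 * (Sg / 2) * Sg := by ring
    _ ≤ 2 * (t ^ 2 * K) * Sg := by gcongr
    _ = K * (2 * (t ^ 2 * Sg)) := by ring
    _ = K * (2 * β ^ 2 * C ^ 2) := by rw [h6]; ring

/-- **Matched saturation forces a Binder floor** (S2 + landed GKS block-field domination + S1, for a given
limit): eventually `1/(2β_c²C²) ≤ g_L`. -/
theorem eventually_binder_ge
    (hdef : ∀ (L : ℕ) (t : ℝ), 0 ≤ t →
      0 < plusExpect 3 (criticalBeta 3) 0 (fun σ => Real.exp (t * ∑ x ∈ box 3 L, spinAt x σ)) ∧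
      (plusExpect 3 (criticalBeta 3) 0 (fun σ => (∑ x ∈ box 3 L, spinAt x σ) ^ 2) * t -
          t ^ 3 * (3 * (plusExpect 3 (criticalBeta 3) 0 (fun σ => (∑ x ∈ box 3 L, spinAt x σ) ^ 2)) ^ 2 -
            plusExpect 3 (criticalBeta 3) 0 (fun σ => (∑ x ∈ box 3 L, spinAt x σ) ^ 4))) *
        plusExpect 3 (criticalBeta 3) 0 (fun σ => Real.exp (t * ∑ x ∈ box 3 L, spinAt x σ)) ≤
      plusExpect 3 (criticalBeta 3) 0
        (fun σ => (∑ x ∈ box 3 L, spinAt x σ) * Real.exp (t * ∑ x ∈ box 3 L, spinAt x σ)))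
    (hiso : ∀ (ρ : ℝ → ℝ) (Δ : ℝ) (S : CorrFamily 3), (∀ δ ∈ Set.Ioc (0:ℝ) 1, 0 < ρ δ) →
      HasPointwiseScalingLimit (criticalCorr 3) ρ S → IsNondegenerateTwoPoint S →
      IsScaleCovariant Δ S →
      ∃ C : ℝ, 0 < C ∧ ∀ᶠ L : ℕ in atTop,
        (2 * (L : ℝ) + 1) ^ 3 * magnetizationInField 3 (criticalBeta 3)
            (C / Real.sqrt (plusExpect 3 (criticalBeta 3) 0 (fun σ => (∑ x ∈ box 3 L, spinAt x σ) ^ 2))) ≤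
          criticalBeta 3 * C / 2 *
            Real.sqrt (plusExpect 3 (criticalBeta 3) 0 (fun σ => (∑ x ∈ box 3 L, spinAt x σ) ^ 2)))
    {ρ : ℝ → ℝ} {Δ : ℝ} {S : CorrFamily 3}
    (hρ : ∀ δ ∈ Set.Ioc (0:ℝ) 1, 0 < ρ δ) (hlim : HasPointwiseScalingLimit (criticalCorr 3) ρ S)
    (hnd : IsNondegenerateTwoPoint S) (hsc : IsScaleCovariant Δ S) :
    ∃ c : ℝ, 0 < c ∧ ∀ᶠ L : ℕ in atTop,
      c ≤ (3 * (plusExpect 3 (criticalBeta 3) 0 (fun σ => (∑ x ∈ box 3 L, spinAt x σ) ^ 2)) ^ 2 -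
              plusExpect 3 (criticalBeta 3) 0 (fun σ => (∑ x ∈ box 3 L, spinAt x σ) ^ 4)) /
            (plusExpect 3 (criticalBeta 3) 0 (fun σ => (∑ x ∈ box 3 L, spinAt x σ) ^ 2)) ^ 2 := by
  have hβ : 0 < criticalBeta 3 := criticalBeta_pos_holds (d := 3) (by norm_num)
  obtain ⟨C, hC, hev⟩ := hiso ρ Δ S hρ hlim hnd hsc
  refine ⟨1 / (2 * criticalBeta 3 ^ 2 * C ^ 2), by positivity, ?_⟩
  filter_upwards [hev] with L hL
  set Sg : ℝ := plusExpect 3 (criticalBeta 3) 0 (fun σ => (∑ x ∈ box 3 L, spinAt x σ) ^ 2) with hSgdef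
  have hSg : 0 < Sg := by
    simpa [hSgdef, Literature.Barriers.CriticalPhenomena.blockVariance,
      Literature.Barriers.CriticalPhenomena.blockSpin] using
      Literature.Barriers.CriticalPhenomena.blockVariance_pos (d := 3) (criticalBeta_nonneg 3) L
  set h : ℝ := C / Real.sqrt Sg with hh
  have hh0 : 0 ≤ h := by positivity
  -- domination at field `h` (tilt `β_c h`)
  have hdom := Summit.CriticalPhenomena.Ising3DConformalLimit.PerfectScreeningCoulombImpliesNontrivial.stub_blockFieldDomination
    L h hh0
  -- deficit at tilt `t = β_c h`
  obtain ⟨hZ, hdefL⟩ := hdef L (criticalBeta 3 * h) (by positivity)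
  have key := binder_lower_of_saturation (β := criticalBeta 3) (C := C) (Sg := Sg)
    (K := 3 * Sg ^ 2 - plusExpect 3 (criticalBeta 3) 0 (fun σ => (∑ x ∈ box 3 L, spinAt x σ) ^ 4))
    hβ hC hSg hZ (by simpa [hh, mul_assoc] using hdefL) hdom (by simpa [hh] using hL)
  simpa [hSgdef] using key

/-- Normalisation glue: every non-degenerate pointwise limit has a normalisation `S'` (zero off
`NonCoincident`) that is again a non-degenerate pointwise limit with the same `ρ`, is scale covariant with
the automatic dimension, and whose `U₄`-non-triviality implies that of `S`. -/
theorem exists_normalised {ρ : ℝ → ℝ} {S : CorrFamily 3}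
    (hρ : ∀ δ ∈ Set.Ioc (0:ℝ) 1, 0 < ρ δ) (hlim : HasPointwiseScalingLimit (criticalCorr 3) ρ S)
    (hnd : IsNondegenerateTwoPoint S) :
    ∃ (Δ : ℝ) (S' : CorrFamily 3), HasPointwiseScalingLimit (criticalCorr 3) ρ S' ∧
      IsNondegenerateTwoPoint S' ∧ IsScaleCovariant Δ S' ∧ (HasNontrivialU4 S' → HasNontrivialU4 S) := by
  classical
  set S' : CorrFamily 3 := fun n z => if Function.Injective z then S n z else 0 with hS'
  have S'_inj : ∀ {n : ℕ} {z : Fin n → EuclideanSpace ℝ (Fin 3)}, Function.Injective z →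
      S' n z = S n z := fun hz => by simp only [hS', if_pos hz]
  have S'_ninj : ∀ {n : ℕ} {z : Fin n → EuclideanSpace ℝ (Fin 3)}, ¬ Function.Injective z →
      S' n z = 0 := fun hz => by simp only [hS', if_neg hz]
  have hlim' : HasPointwiseScalingLimit (criticalCorr 3) ρ S' :=
    fun n => (hlim n).congr_right fun z hz => (S'_inj hz).symm
  have hnd' : IsNondegenerateTwoPoint S' := fun z hz => by rw [S'_inj hz]; exact hnd z hz
  obtain ⟨Δ, -, hcov⟩ := hlim'.exists_rpow_scale_mem_Icc hρ hnd'
  have hsc' : IsScaleCovariant Δ S' := by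
    intro n c hc z
    by_cases hz : Function.Injective z
    · exact hcov n c hc z hz
    · have hz' : ¬ Function.Injective (fun i => c • z i) := fun h =>
        hz ((smul_right_injective (EuclideanSpace ℝ (Fin 3)) hc.ne').of_comp_iff z |>.1 h)
      rw [S'_ninj hz', S'_ninj hz, mul_zero]
  refine ⟨Δ, S', hlim', hnd', hsc', ?_⟩
  rintro ⟨x, hx, hne⟩
  refine ⟨x, hx, ?_⟩
  have hinj : Function.Injective x := hx
  have hpair : ∀ i j : Fin 4, i ≠ j → S' 2 ![x i, x j] = S 2 ![x i, x j] := by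
    intro i j hij
    exact S'_inj (pair_mem_nonCoincident (d := 3) fun h => hij (hinj h))
  have h4 : S' 4 x = S 4 x := S'_inj hinj
  simp only [limitConnectedFour] at hne ⊢
  rwa [h4, hpair 0 1 (by decide), hpair 2 3 (by decide), hpair 0 2 (by decide), hpair 1 3 (by decide),
    hpair 0 3 (by decide), hpair 1 2 (by decide)] at hne

/-- **COMPOSITION.** S2 (Lee–Yang deficit) and S1 (matched upper critical isotherm) give the crux
`IsingEuclidUpgradeR4NonGaussian` — the IsingEuclidUpgrade decl of item stmt-CriticalPhenomena-0636, by name. -/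
theorem IsingEuclidUpgradeR4NonGaussian_of :
    (∀ (L : ℕ) (t : ℝ), 0 ≤ t →
      0 < plusExpect 3 (criticalBeta 3) 0 (fun σ => Real.exp (t * ∑ x ∈ box 3 L, spinAt x σ)) ∧
      (plusExpect 3 (criticalBeta 3) 0 (fun σ => (∑ x ∈ box 3 L, spinAt x σ) ^ 2) * t -
          t ^ 3 * (3 * (plusExpect 3 (criticalBeta 3) 0 (fun σ => (∑ x ∈ box 3 L, spinAt x σ) ^ 2)) ^ 2 -
            plusExpect 3 (criticalBeta 3) 0 (fun σ => (∑ x ∈ box 3 L, spinAt x σ) ^ 4))) *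
        plusExpect 3 (criticalBeta 3) 0 (fun σ => Real.exp (t * ∑ x ∈ box 3 L, spinAt x σ)) ≤
      plusExpect 3 (criticalBeta 3) 0
        (fun σ => (∑ x ∈ box 3 L, spinAt x σ) * Real.exp (t * ∑ x ∈ box 3 L, spinAt x σ))) →
    (∀ (ρ : ℝ → ℝ) (Δ : ℝ) (S : CorrFamily 3), (∀ δ ∈ Set.Ioc (0:ℝ) 1, 0 < ρ δ) →
      HasPointwiseScalingLimit (criticalCorr 3) ρ S → IsNondegenerateTwoPoint S →
      IsScaleCovariant Δ S →
      ∃ C : ℝ, 0 < C ∧ ∀ᶠ L : ℕ in atTop,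
        (2 * (L : ℝ) + 1) ^ 3 * magnetizationInField 3 (criticalBeta 3)
            (C / Real.sqrt (plusExpect 3 (criticalBeta 3) 0 (fun σ => (∑ x ∈ box 3 L, spinAt x σ) ^ 2))) ≤
          criticalBeta 3 * C / 2 *
            Real.sqrt (plusExpect 3 (criticalBeta 3) 0 (fun σ => (∑ x ∈ box 3 L, spinAt x σ) ^ 2))) →
    Summit.CriticalPhenomena.Ising3DConformalLimit.Theses.IsingEuclidUpgrade.IsingEuclidUpgradeR4NonGaussian := by
  intro hdef hiso ρ S hρ hlim hnd
  obtain ⟨Δ, S', hlim', hnd', hsc', hback⟩ := exists_normalised hρ hlim hnd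
  refine hback ?_
  by_contra hU4
  have htend := Summit.CriticalPhenomena.Ising3DConformalLimit.LeeYangGapGaussianLimitKillsBlockCoupling.gaussianLimitKillsBlockCoupling_proof
    ρ Δ S' hρ hlim' hnd' hsc' hU4
  obtain ⟨c, hc, hlow⟩ := eventually_binder_ge hdef hiso hρ hlim' hnd' hsc'
  have hup := htend.eventually (gt_mem_nhds hc)
  obtain ⟨L, h1, h2⟩ := (hlow.and hup).exists
  exact absurd h1 (not_le.2 h2)

/-- **COMPOSITION** for the HyperoctahedralRP copy of the shared decl (primary route of the crux chain;
definitionally the same statement). -/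
theorem IsingEuclidUpgradeR4NonGaussian_of_hyperoctahedralRP :
    (∀ (L : ℕ) (t : ℝ), 0 ≤ t →
      0 < plusExpect 3 (criticalBeta 3) 0 (fun σ => Real.exp (t * ∑ x ∈ box 3 L, spinAt x σ)) ∧
      (plusExpect 3 (criticalBeta 3) 0 (fun σ => (∑ x ∈ box 3 L, spinAt x σ) ^ 2) * t -
          t ^ 3 * (3 * (plusExpect 3 (criticalBeta 3) 0 (fun σ => (∑ x ∈ box 3 L, spinAt x σ) ^ 2)) ^ 2 -
            plusExpect 3 (criticalBeta 3) 0 (fun σ => (∑ x ∈ box 3 L, spinAt x σ) ^ 4))) *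
        plusExpect 3 (criticalBeta 3) 0 (fun σ => Real.exp (t * ∑ x ∈ box 3 L, spinAt x σ)) ≤
      plusExpect 3 (criticalBeta 3) 0
        (fun σ => (∑ x ∈ box 3 L, spinAt x σ) * Real.exp (t * ∑ x ∈ box 3 L, spinAt x σ))) →
    (∀ (ρ : ℝ → ℝ) (Δ : ℝ) (S : CorrFamily 3), (∀ δ ∈ Set.Ioc (0:ℝ) 1, 0 < ρ δ) →
      HasPointwiseScalingLimit (criticalCorr 3) ρ S → IsNondegenerateTwoPoint S →
      IsScaleCovariant Δ S →
      ∃ C : ℝ, 0 < C ∧ ∀ᶠ L : ℕ in atTop,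
        (2 * (L : ℝ) + 1) ^ 3 * magnetizationInField 3 (criticalBeta 3)
            (C / Real.sqrt (plusExpect 3 (criticalBeta 3) 0 (fun σ => (∑ x ∈ box 3 L, spinAt x σ) ^ 2))) ≤
          criticalBeta 3 * C / 2 *
            Real.sqrt (plusExpect 3 (criticalBeta 3) 0 (fun σ => (∑ x ∈ box 3 L, spinAt x σ) ^ 2))) →
    Summit.CriticalPhenomena.Ising3DConformalLimit.Theses.HyperoctahedralRP.IsingEuclidUpgradeR4NonGaussian :=
  fun hdef hiso => IsingEuclidUpgradeR4NonGaussian_of hdef hiso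

/-- **COMPOSITION (second entrance).** S2, S4 and the shared crux S3 (`OneArmHyperscaling`,
stmt-CriticalPhenomena-15591) give the crux. -/
theorem IsingEuclidUpgradeR4NonGaussian_of_oneArm :
    (∀ (L : ℕ) (t : ℝ), 0 ≤ t →
      0 < plusExpect 3 (criticalBeta 3) 0 (fun σ => Real.exp (t * ∑ x ∈ box 3 L, spinAt x σ)) ∧
      (plusExpect 3 (criticalBeta 3) 0 (fun σ => (∑ x ∈ box 3 L, spinAt x σ) ^ 2) * t -
          t ^ 3 * (3 * (plusExpect 3 (criticalBeta 3) 0 (fun σ => (∑ x ∈ box 3 L, spinAt x σ) ^ 2)) ^ 2 -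
            plusExpect 3 (criticalBeta 3) 0 (fun σ => (∑ x ∈ box 3 L, spinAt x σ) ^ 4))) *
        plusExpect 3 (criticalBeta 3) 0 (fun σ => Real.exp (t * ∑ x ∈ box 3 L, spinAt x σ)) ≤
      plusExpect 3 (criticalBeta 3) 0
        (fun σ => (∑ x ∈ box 3 L, spinAt x σ) * Real.exp (t * ∑ x ∈ box 3 L, spinAt x σ))) →
    (Summit.CriticalPhenomena.Ising3DConformalLimit.Theses.ArmHyperscaling.OneArmHyperscaling →
    ∀ (ρ : ℝ → ℝ) (Δ : ℝ) (S : CorrFamily 3), (∀ δ ∈ Set.Ioc (0:ℝ) 1, 0 < ρ δ) →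
      HasPointwiseScalingLimit (criticalCorr 3) ρ S → IsNondegenerateTwoPoint S →
      IsScaleCovariant Δ S →
      ∃ C : ℝ, 0 < C ∧ ∀ᶠ L : ℕ in atTop,
        (2 * (L : ℝ) + 1) ^ 3 * magnetizationInField 3 (criticalBeta 3)
            (C / Real.sqrt (plusExpect 3 (criticalBeta 3) 0 (fun σ => (∑ x ∈ box 3 L, spinAt x σ) ^ 2))) ≤
          criticalBeta 3 * C / 2 *
            Real.sqrt (plusExpect 3 (criticalBeta 3) 0 (fun σ => (∑ x ∈ box 3 L, spinAt x σ) ^ 2))) →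
    Summit.CriticalPhenomena.Ising3DConformalLimit.Theses.ArmHyperscaling.OneArmHyperscaling →
    Summit.CriticalPhenomena.Ising3DConformalLimit.Theses.IsingEuclidUpgrade.IsingEuclidUpgradeR4NonGaussian :=
  fun hdef hS4 hOA => IsingEuclidUpgradeR4NonGaussian_of hdef (hS4 hOA)

/-- The crux from the registered stubs (what the lead closes stub by stub). -/
theorem IsingEuclidUpgradeR4NonGaussian_of_stubs :
    Summit.CriticalPhenomena.Ising3DConformalLimit.Theses.IsingEuclidUpgrade.IsingEuclidUpgradeR4NonGaussian :=
  IsingEuclidUpgradeR4NonGaussian_of stub_leeYangDeficit stub_matchedUpperIsotherm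

/-- … and through the one-arm entrance. -/
theorem IsingEuclidUpgradeR4NonGaussian_of_stubs_oneArm :
    Summit.CriticalPhenomena.Ising3DConformalLimit.Theses.HyperoctahedralRP.IsingEuclidUpgradeR4NonGaussian :=
  IsingEuclidUpgradeR4NonGaussian_of_oneArm stub_leeYangDeficit stub_oneArmGivesMatchedIsotherm
    stub_oneArmHyperscaling

end Summit.CriticalPhenomena.Ising3DConformalLimit.Cruxes.IsingEuclidUpgradeR4NonGaussian.IsothermSaturationLeeYang

end
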